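import Summits.CriticalPhenomena.PercolationContinuityZ3.Theorems.PercNearOneGluingNoHeavyLowerTailAPLVwTwoLoad
import HarnessLib

/-!
# `NoHeavyLowerTail` (stmt-CriticalPhenomena-4575) — (V_w) for THREE loaded vertices: the algebraic reduction to one
# per-pair inequality (♣) between the APL-G threshold and a rational function

Support file (prover prim-ineq-gen-8 gen 51; `--supports stmt-CriticalPhenomena-4575`; memo
run/shared/lean/prim/prim-ineq-gen-8/FINDING-gen51-TWOLOAD.md §6c–§6g).  No definitions, no named facts, no sorries; pure real algebra.

SETTING (memo §6c).  Apex `o`, `K = C(o)`, loads `x, y, z ≥ 0` on `u, v, w`; `p_a = P(a∈K)`, `κ_ab = P(a,b∈K) − p_ap_b`, `m_ab = P(a↔b off K)`,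
`χ_a = P(a∈K, b↔c off K)`.  Then EXACTLY
  `W = Σ_a ℓ_a(ℓ_ap_a(1−p_a) + Σ_{b≠a}ℓ_bκ_ab)²/p_a`,
  `2|Cov(L,R)| = 2Σ_aℓ_a³p_a(1−p_a) + 2Σ_{a≠b}ℓ_aℓ_b²κ_ab + 4Σ_{b<c}m_bcℓ_bℓ_c(ℓ_bp_b+ℓ_cp_c) + 4xyz·Σ_a(p_am_bc − χ_a)`.
The memo proves `W ≤ 2|Cov(L,R)|` for every finite graph and every load on ≤ 3 vertices (two loads: `…APLVwTwoLoad.lean`; three loads: this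
reduction + the per-pair lemma (♣), proved there by pencil ((B2)) and by an exact-arithmetic certificate ((B1), `certB1.py`)).
THIS FILE machine-checks the algebraic skeleton [this work]:
* `threeLoad_cancellation` (ring): with the `χ`-terms at their Harris bound, `W − 2|C| = Σ_aℓ_a(Σ_{b≠a}ℓ_bκ_ab)²/p_a − Σ_aℓ_a³p_a(1−p_a²)
  − 2Σ_{a<b}(κ_ab+2m_ab)ℓ_aℓ_b(ℓ_ap_a+ℓ_bp_b)` — the `ℓ_a²ℓ_b` cross terms cancel;
* `threeLoad_sq_div_expand`, `threeLoad_clear_denoms` (helpers), `threeLoad_cs_term` (Cauchy–Schwarz per vertex), `holder_pair_poly4` (`(A+B)²(u³B²+v³A²) − (u+v)³A²B² = (uB−vA)²(u(B²+2AB)+v(A²+2AB))`),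
  `four_uv_le_cube`;
* `threeLoad_pair_nonpos`: the per-pair functional
  `Ψ = 2κ²ℓ_aℓ_b(ℓ_b/p_a+ℓ_a/p_b) − 2(κ+2m)ℓ_aℓ_b(ℓ_ap_a+ℓ_bp_b) − ½[ℓ_a³p_a(1−p_a²)+ℓ_b³p_b(1−p_b²)]` is `≤ 0` as soon as
  (♣) `(κ² − κP − 2Pm)(Ã+B̃)² ≤ P²` (`P = p_ap_b`, `Ã²(1−p_a²) = p_a²`, `B̃²(1−p_b²) = p_b²`, i.e. `Ã = p_a/√(1−p_a²)`);
* **`threeLoad_vw_of_pairs`**: `χ_a ≤ p_am_bc` (the conditional-Harris lemma of the memo) and (♣) for the three pairs imply `W ≤ 2|Cov(L,R)|`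
  for all `x, y, z ≥ 0`.  In percolation (♣) follows from APL-G at the apex (memo §6f–§6g); that last step is not formalised here.
-/

noncomputable section

namespace Summit.CriticalPhenomena.PercolationContinuityZ3.Theorems

namespace APL

/-- Expansion helper: `x(xpq + S)²/p = x³pq² + 2x²qS + xS²/p` for `p ≠ 0`. [folklore] -/
theorem threeLoad_sq_div_expand (x p q s t : ℝ) (hp : p ≠ 0) :
    x * (x * p * q + s + t) ^ 2 / p = x ^ 3 * p * q ^ 2 + 2 * x ^ 2 * q * (s + t) + x * (s + t) ^ 2 / p := by
  have h : x * (x * p * q + s + t) ^ 2 = (x ^ 3 * p * q ^ 2 + 2 * x ^ 2 * q * (s + t)) * p + x * (s + t) ^ 2 := by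
    ring
  rw [h, add_div, mul_div_cancel_right₀ _ hp]

/-- Helper: `pq(b/p + a/q) = bq + ap` for `p, q ≠ 0`. [folklore] -/
theorem threeLoad_clear_denoms (p q a b : ℝ) (hp : p ≠ 0) (hq : q ≠ 0) :
    p * q * (b / p + a / q) = b * q + a * p := by
  rw [mul_add, mul_comm p q, mul_assoc, mul_div_cancel₀ _ hp, mul_comm q p, mul_assoc, mul_div_cancel₀ _ hq]
  ring

/-- **Cancellation identity** (memo §6e step (3)): the `ℓ_a²ℓ_b` cross terms of `W − 2|C|` cancel pairwise. [this work] -/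
theorem threeLoad_cancellation (pu pv pw kuv kuw kvw muv muw mvw x y z : ℝ) (hpu : pu ≠ 0) (hpv : pv ≠ 0) (hpw : pw ≠ 0) :
    (x * (x * pu * (1 - pu) + y * kuv + z * kuw) ^ 2 / pu + y * (y * pv * (1 - pv) + x * kuv + z * kvw) ^ 2 / pv
        + z * (z * pw * (1 - pw) + x * kuw + y * kvw) ^ 2 / pw)
      - (2 * (x ^ 3 * pu * (1 - pu) + y ^ 3 * pv * (1 - pv) + z ^ 3 * pw * (1 - pw))
          + 2 * (x * y ^ 2 * kuv + y * x ^ 2 * kuv + x * z ^ 2 * kuw + z * x ^ 2 * kuw + y * z ^ 2 * kvw + z * y ^ 2 * kvw)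
          + 4 * (muv * x * y * (x * pu + y * pv) + muw * x * z * (x * pu + z * pw) + mvw * y * z * (y * pv + z * pw)))
      = (x * (y * kuv + z * kuw) ^ 2 / pu + y * (x * kuv + z * kvw) ^ 2 / pv + z * (x * kuw + y * kvw) ^ 2 / pw)
        - (x ^ 3 * pu * (1 - pu ^ 2) + y ^ 3 * pv * (1 - pv ^ 2) + z ^ 3 * pw * (1 - pw ^ 2))
        - 2 * ((kuv + 2 * muv) * x * y * (x * pu + y * pv) + (kuw + 2 * muw) * x * z * (x * pu + z * pw)
          + (kvw + 2 * mvw) * y * z * (y * pv + z * pw)) := by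
  have e1 := threeLoad_sq_div_expand x pu (1 - pu) (y * kuv) (z * kuw) hpu
  have e2 := threeLoad_sq_div_expand y pv (1 - pv) (x * kuv) (z * kvw) hpv
  have e3 := threeLoad_sq_div_expand z pw (1 - pw) (x * kuw) (y * kvw) hpw
  rw [e1, e2, e3]
  ring

/-- Cauchy–Schwarz per vertex: `x(s+t)²/p ≤ 2x(s²+t²)/p` for `x ≥ 0`, `p > 0`. [folklore] -/
theorem threeLoad_cs_term (x p s t : ℝ) (hx : 0 ≤ x) (hp : 0 < p) :
    x * (s + t) ^ 2 / p ≤ 2 * x * (s ^ 2 + t ^ 2) / p := by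
  have hxp : 0 ≤ x / p := div_nonneg hx hp.le
  have h2 : (s + t) ^ 2 ≤ 2 * (s ^ 2 + t ^ 2) := by nlinarith [sq_nonneg (s - t)]
  calc x * (s + t) ^ 2 / p = (x / p) * (s + t) ^ 2 := by ring
    _ ≤ (x / p) * (2 * (s ^ 2 + t ^ 2)) := mul_le_mul_of_nonneg_left h2 hxp
    _ = 2 * x * (s ^ 2 + t ^ 2) / p := by ring

/-- Hölder in polynomial form: `(u+v)³A²B² ≤ (A+B)²(u³B² + v³A²)` for `A, B, u, v ≥ 0`; the difference is
`(uB − vA)²(u(B²+2AB) + v(A²+2AB))`. [folklore] -/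
theorem holder_pair_poly4 (A B u v : ℝ) (hA : 0 ≤ A) (hB : 0 ≤ B) (hu : 0 ≤ u) (hv : 0 ≤ v) :
    (u + v) ^ 3 * (A ^ 2 * B ^ 2) ≤ (A + B) ^ 2 * (u ^ 3 * B ^ 2 + v ^ 3 * A ^ 2) := by
  have hid : (A + B) ^ 2 * (u ^ 3 * B ^ 2 + v ^ 3 * A ^ 2) - (u + v) ^ 3 * (A ^ 2 * B ^ 2)
      = (u * B - v * A) ^ 2 * (u * (B ^ 2 + 2 * A * B) + v * (A ^ 2 + 2 * A * B)) := by ring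
  have hnn : 0 ≤ (u * B - v * A) ^ 2 * (u * (B ^ 2 + 2 * A * B) + v * (A ^ 2 + 2 * A * B)) := by positivity
  linarith

/-- `4uv(u+v) ≤ (u+v)³` for `u, v ≥ 0`. [folklore] -/
theorem four_uv_le_cube (u v : ℝ) (hu : 0 ≤ u) (hv : 0 ≤ v) : 4 * u * v * (u + v) ≤ (u + v) ^ 3 := by
  have hid : (u + v) ^ 3 - 4 * u * v * (u + v) = (u + v) * (u - v) ^ 2 := by ring
  have hnn : 0 ≤ (u + v) * (u - v) ^ 2 := mul_nonneg (add_nonneg hu hv) (sq_nonneg (u - v))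
  linarith

/-- **Per-pair lemma** (memo §6e steps (6)–(7)).  For `0 < p_a, p_b`, loads `ℓ_a, ℓ_b ≥ 0`, reals `Ã, B̃ > 0` with `Ã²(1−p_a²) = p_a²`,
`B̃²(1−p_b²) = p_b²`, and (♣) `(κ² − κP − 2Pm)(Ã+B̃)² ≤ P²` (`P = p_ap_b`):
`2κ²ℓ_aℓ_b(ℓ_b/p_a+ℓ_a/p_b) − 2(κ+2m)ℓ_aℓ_b(ℓ_ap_a+ℓ_bp_b) − ½[ℓ_a³p_a(1−p_a²)+ℓ_b³p_b(1−p_b²)] ≤ 0`. [this work] -/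
theorem threeLoad_pair_nonpos (pa pb κ m la lb At Bt : ℝ) (hpa : 0 < pa) (hpb : 0 < pb) (hla : 0 ≤ la) (hlb : 0 ≤ lb)
    (hAt : 0 < At) (hBt : 0 < Bt) (hA : At ^ 2 * (1 - pa ^ 2) = pa ^ 2) (hB : Bt ^ 2 * (1 - pb ^ 2) = pb ^ 2)
    (hclub : (κ ^ 2 - κ * (pa * pb) - 2 * (pa * pb) * m) * (At + Bt) ^ 2 ≤ (pa * pb) ^ 2) :
    2 * κ ^ 2 * la * lb * (lb / pa + la / pb) - 2 * (κ + 2 * m) * la * lb * (la * pa + lb * pb)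
      - (1 / 2) * (la ^ 3 * pa * (1 - pa ^ 2) + lb ^ 3 * pb * (1 - pb ^ 2)) ≤ 0 := by
  have hu0 : 0 ≤ la * pa := mul_nonneg hla hpa.le
  have hv0 : 0 ≤ lb * pb := mul_nonneg hlb hpb.le
  have hP : 0 < pa * pb := mul_pos hpa hpb
  -- (1) multiply the goal by `pa pb > 0`
  have hcd := threeLoad_clear_denoms pa pb la lb hpa.ne' hpb.ne'
  have hmul : pa * pb * (2 * κ ^ 2 * la * lb * (lb / pa + la / pb) - 2 * (κ + 2 * m) * la * lb * (la * pa + lb * pb)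
      - (1 / 2) * (la ^ 3 * pa * (1 - pa ^ 2) + lb ^ 3 * pb * (1 - pb ^ 2)))
      = la * lb * (la * pa + lb * pb) * (2 * κ ^ 2 - 2 * (κ + 2 * m) * (pa * pb))
        - (1 / 2) * (pa * pb) * (la ^ 3 * pa * (1 - pa ^ 2) + lb ^ 3 * pb * (1 - pb ^ 2)) := by
    calc pa * pb * (2 * κ ^ 2 * la * lb * (lb / pa + la / pb) - 2 * (κ + 2 * m) * la * lb * (la * pa + lb * pb)
          - (1 / 2) * (la ^ 3 * pa * (1 - pa ^ 2) + lb ^ 3 * pb * (1 - pb ^ 2)))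
        = 2 * κ ^ 2 * la * lb * (pa * pb * (lb / pa + la / pb))
          - pa * pb * (2 * (κ + 2 * m) * la * lb * (la * pa + lb * pb))
          - (1 / 2) * (pa * pb) * (la ^ 3 * pa * (1 - pa ^ 2) + lb ^ 3 * pb * (1 - pb ^ 2)) := by ring
      _ = la * lb * (la * pa + lb * pb) * (2 * κ ^ 2 - 2 * (κ + 2 * m) * (pa * pb))
          - (1 / 2) * (pa * pb) * (la ^ 3 * pa * (1 - pa ^ 2) + lb ^ 3 * pb * (1 - pb ^ 2)) := by rw [hcd]; ring
  -- (2) Hölder + AM–GM in polynomial form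
  have hH := holder_pair_poly4 At Bt (la * pa) (lb * pb) hAt.le hBt.le hu0 hv0
  have h4 := four_uv_le_cube (la * pa) (lb * pb) hu0 hv0
  have hAB2 : 0 ≤ At ^ 2 * Bt ^ 2 := by positivity
  have h5 := le_trans (mul_le_mul_of_nonneg_right h4 hAB2) hH
  -- translate `u³ Bt²`, `v³ At²` back with `Ã²(1−p_a²) = p_a²`
  have eu : (la * pa) ^ 3 * Bt ^ 2 = la ^ 3 * pa * (1 - pa ^ 2) * (At ^ 2 * Bt ^ 2) := by
    linear_combination (-(la ^ 3 * pa * Bt ^ 2)) * hA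
  have ev : (lb * pb) ^ 3 * At ^ 2 = lb ^ 3 * pb * (1 - pb ^ 2) * (At ^ 2 * Bt ^ 2) := by
    linear_combination (-(lb ^ 3 * pb * At ^ 2)) * hB
  have hABpos : 0 < At ^ 2 * Bt ^ 2 := by positivity
  -- divide by `At² Bt² > 0`
  have h5' : (4 * (pa * pb) * (la * lb * (la * pa + lb * pb))) * (At ^ 2 * Bt ^ 2)
      ≤ ((At + Bt) ^ 2 * (la ^ 3 * pa * (1 - pa ^ 2) + lb ^ 3 * pb * (1 - pb ^ 2))) * (At ^ 2 * Bt ^ 2) := by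
    calc (4 * (pa * pb) * (la * lb * (la * pa + lb * pb))) * (At ^ 2 * Bt ^ 2)
        = 4 * (la * pa) * (lb * pb) * (la * pa + lb * pb) * (At ^ 2 * Bt ^ 2) := by ring
      _ ≤ (At + Bt) ^ 2 * ((la * pa) ^ 3 * Bt ^ 2 + (lb * pb) ^ 3 * At ^ 2) := h5
      _ = ((At + Bt) ^ 2 * (la ^ 3 * pa * (1 - pa ^ 2) + lb ^ 3 * pb * (1 - pb ^ 2))) * (At ^ 2 * Bt ^ 2) := by
          rw [eu, ev]; ring
  have h6 : 4 * (pa * pb) * (la * lb * (la * pa + lb * pb))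
      ≤ (At + Bt) ^ 2 * (la ^ 3 * pa * (1 - pa ^ 2) + lb ^ 3 * pb * (1 - pb ^ 2)) :=
    le_of_mul_le_mul_right h5' hABpos
  -- (3) combine with (♣)
  have hLnn : 0 ≤ la * lb * (la * pa + lb * pb) := by positivity
  have t7 := mul_le_mul_of_nonneg_left hclub hLnn
  have h7 : la * lb * (la * pa + lb * pb) * (2 * κ ^ 2 - 2 * (κ + 2 * m) * (pa * pb)) * (At + Bt) ^ 2
      ≤ 2 * (pa * pb) ^ 2 * (la * lb * (la * pa + lb * pb)) := by
    calc la * lb * (la * pa + lb * pb) * (2 * κ ^ 2 - 2 * (κ + 2 * m) * (pa * pb)) * (At + Bt) ^ 2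
        = 2 * (la * lb * (la * pa + lb * pb) * ((κ ^ 2 - κ * (pa * pb) - 2 * (pa * pb) * m) * (At + Bt) ^ 2)) := by ring
      _ ≤ 2 * (la * lb * (la * pa + lb * pb) * (pa * pb) ^ 2) := by linarith [t7]
      _ = 2 * (pa * pb) ^ 2 * (la * lb * (la * pa + lb * pb)) := by ring
  have hP2 : 0 ≤ pa * pb / 2 := by positivity
  have t8 := mul_le_mul_of_nonneg_left h6 hP2
  have h8 : 2 * (pa * pb) ^ 2 * (la * lb * (la * pa + lb * pb))
      ≤ (1 / 2) * (pa * pb) * ((At + Bt) ^ 2 * (la ^ 3 * pa * (1 - pa ^ 2) + lb ^ 3 * pb * (1 - pb ^ 2))) := by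
    calc 2 * (pa * pb) ^ 2 * (la * lb * (la * pa + lb * pb))
        = pa * pb / 2 * (4 * (pa * pb) * (la * lb * (la * pa + lb * pb))) := by ring
      _ ≤ pa * pb / 2 * ((At + Bt) ^ 2 * (la ^ 3 * pa * (1 - pa ^ 2) + lb ^ 3 * pb * (1 - pb ^ 2))) := t8
      _ = (1 / 2) * (pa * pb) * ((At + Bt) ^ 2 * (la ^ 3 * pa * (1 - pa ^ 2) + lb ^ 3 * pb * (1 - pb ^ 2))) := by ring
  have hABsq : 0 < (At + Bt) ^ 2 := by positivity
  -- `(pa pb) · goal · (At+Bt)² ≤ 0`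
  have h9 : (pa * pb * (2 * κ ^ 2 * la * lb * (lb / pa + la / pb) - 2 * (κ + 2 * m) * la * lb * (la * pa + lb * pb)
      - (1 / 2) * (la ^ 3 * pa * (1 - pa ^ 2) + lb ^ 3 * pb * (1 - pb ^ 2)))) * (At + Bt) ^ 2 ≤ 0 := by
    rw [hmul]
    have hsplit : (la * lb * (la * pa + lb * pb) * (2 * κ ^ 2 - 2 * (κ + 2 * m) * (pa * pb))
        - (1 / 2) * (pa * pb) * (la ^ 3 * pa * (1 - pa ^ 2) + lb ^ 3 * pb * (1 - pb ^ 2))) * (At + Bt) ^ 2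
        = la * lb * (la * pa + lb * pb) * (2 * κ ^ 2 - 2 * (κ + 2 * m) * (pa * pb)) * (At + Bt) ^ 2
          - (1 / 2) * (pa * pb) * ((At + Bt) ^ 2 * (la ^ 3 * pa * (1 - pa ^ 2) + lb ^ 3 * pb * (1 - pb ^ 2))) := by ring
    rw [hsplit]
    linarith [h7, h8]
  have h10 : pa * pb * (2 * κ ^ 2 * la * lb * (lb / pa + la / pb) - 2 * (κ + 2 * m) * la * lb * (la * pa + lb * pb)
      - (1 / 2) * (la ^ 3 * pa * (1 - pa ^ 2) + lb ^ 3 * pb * (1 - pb ^ 2))) ≤ 0 := by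
    by_contra hneg
    push Not at hneg
    have := mul_pos hneg hABsq
    linarith
  by_contra hneg
  push Not at hneg
  have := mul_pos hP hneg
  linarith

/-- **Three-load (V_w) from the per-pair inequalities** (memo §6e).  For `0 < p_a` (three vertices), loads `x,y,z ≥ 0`, the
Harris-type bounds `χ_a ≤ p_am_bc`, and (♣) for the three pairs (with `Ã_a²(1−p_a²) = p_a²`, `Ã_a > 0`), the three-load (V_w)
inequality `W ≤ 2|Cov(L,R)|` holds in the expanded form of the module docstring. [this work] -/
theorem threeLoad_vw_of_pairs (pu pv pw kuv kuw kvw muv muw mvw cu cv cw x y z Au Av Aw : ℝ)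
    (hpu : 0 < pu) (hpv : 0 < pv) (hpw : 0 < pw) (hx : 0 ≤ x) (hy : 0 ≤ y) (hz : 0 ≤ z)
    (hAu : 0 < Au) (hAv : 0 < Av) (hAw : 0 < Aw)
    (hAu2 : Au ^ 2 * (1 - pu ^ 2) = pu ^ 2) (hAv2 : Av ^ 2 * (1 - pv ^ 2) = pv ^ 2) (hAw2 : Aw ^ 2 * (1 - pw ^ 2) = pw ^ 2)
    (hcu : cu ≤ pu * mvw) (hcv : cv ≤ pv * muw) (hcw : cw ≤ pw * muv)
    (club_uv : (kuv ^ 2 - kuv * (pu * pv) - 2 * (pu * pv) * muv) * (Au + Av) ^ 2 ≤ (pu * pv) ^ 2)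
    (club_uw : (kuw ^ 2 - kuw * (pu * pw) - 2 * (pu * pw) * muw) * (Au + Aw) ^ 2 ≤ (pu * pw) ^ 2)
    (club_vw : (kvw ^ 2 - kvw * (pv * pw) - 2 * (pv * pw) * mvw) * (Av + Aw) ^ 2 ≤ (pv * pw) ^ 2) :
    x * (x * pu * (1 - pu) + y * kuv + z * kuw) ^ 2 / pu + y * (y * pv * (1 - pv) + x * kuv + z * kvw) ^ 2 / pv
        + z * (z * pw * (1 - pw) + x * kuw + y * kvw) ^ 2 / pw
      ≤ 2 * (x ^ 3 * pu * (1 - pu) + y ^ 3 * pv * (1 - pv) + z ^ 3 * pw * (1 - pw))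
          + 2 * (x * y ^ 2 * kuv + y * x ^ 2 * kuv + x * z ^ 2 * kuw + z * x ^ 2 * kuw + y * z ^ 2 * kvw + z * y ^ 2 * kvw)
          + 4 * (muv * x * y * (x * pu + y * pv) + muw * x * z * (x * pu + z * pw) + mvw * y * z * (y * pv + z * pw))
          + 4 * x * y * z * ((pu * mvw - cu) + (pv * muw - cv) + (pw * muv - cw)) := by
  -- the χ-terms are nonnegative
  have hchi : 0 ≤ 4 * x * y * z * ((pu * mvw - cu) + (pv * muw - cv) + (pw * muv - cw)) := by
    have : 0 ≤ (pu * mvw - cu) + (pv * muw - cv) + (pw * muv - cw) := by linarith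
    positivity
  have hid := threeLoad_cancellation pu pv pw kuv kuw kvw muv muw mvw x y z hpu.ne' hpv.ne' hpw.ne'
  have c1 := threeLoad_cs_term x pu (y * kuv) (z * kuw) hx hpu
  have c2 := threeLoad_cs_term y pv (x * kuv) (z * kvw) hy hpv
  have c3 := threeLoad_cs_term z pw (x * kuw) (y * kvw) hz hpw
  have q1 := threeLoad_pair_nonpos pu pv kuv muv x y Au Av hpu hpv hx hy hAu hAv hAu2 hAv2 club_uv
  have q2 := threeLoad_pair_nonpos pu pw kuw muw x z Au Aw hpu hpw hx hz hAu hAw hAu2 hAw2 club_uw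
  have q3 := threeLoad_pair_nonpos pv pw kvw mvw y z Av Aw hpv hpw hy hz hAv hAw hAv2 hAw2 club_vw
  have regroup : 2 * x * ((y * kuv) ^ 2 + (z * kuw) ^ 2) / pu + 2 * y * ((x * kuv) ^ 2 + (z * kvw) ^ 2) / pv
      + 2 * z * ((x * kuw) ^ 2 + (y * kvw) ^ 2) / pw
      = 2 * kuv ^ 2 * x * y * (y / pu + x / pv) + 2 * kuw ^ 2 * x * z * (z / pu + x / pw)
        + 2 * kvw ^ 2 * y * z * (z / pv + y / pw) := by
    ring
  linarith [hid, c1, c2, c3, q1, q2, q3, regroup, hchi]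

end APL

end Summit.CriticalPhenomena.PercolationContinuityZ3.Theorems
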